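import Summits.Ventures.LatticeQCDFlow.Scaling.TightSectorGapLaw

/-!
HONEST FRAMING: exact (Metropolis-corrected) sampling algorithms for lattice gauge theory; figures
of merit are autocorrelation/cost numbers at stated couplings and volumes; no continuum-physics
claim.

# TightSectorWitness — THE QUALITY-`p` INSTANCE THAT PAYS `1/p`: ON TWO POINTS WITH COLD LAWS `(θ, 1−θ)`, HOT LAW `(pθ, 1−pθ)` AND IDENTITY
# MAPS, ONE-SIDED TRANSPORTED DOMINATION HOLDS WITH CONSTANT EXACTLY `p`, THE SECTOR `{⊤}` IS TIGHT WITH `p' = p`, AND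
# `p·min{ct/(3m), (1−t)w_0/(7K)} ≤ Gap ≤ (p/(K(1−θ)))·min{t, (1−t)w_0}`, `t_rel ≥ (1−θ)K/(p·min{t,(1−t)w_0})` — FOR EVERY `K`, EVERY HUB LIST,
# EVERY SWAP FRACTION AND ALLOCATION: THE LINEAR DEPENDENCE OF CHAPTER N'S LAWS ON THE MAP QUALITY IS ATTAINED (lean-2 GEN-29, ours)

Venture-side (OURS).  Cell `lqcd-flow` (pub-lqcd), unit `pub-lqcd-lean-2-g29`, 2026-08-28.  Chapter O (the floor sees the map quality), file 4:
the existence half of OPEN-MATH-chapterM item 8.  `Scaling/TightSectorGapLaw` (O1) proved the two-sided law at a tight sector with ceiling constant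
`p' ≥ p`; here the hypotheses are DISCHARGED on an explicit instance with `p' = p`: `S = Bool`, `μ_k = (θ, 1−θ)` at every cold level, `μ_0 = (pθ, 1−pθ)`,
all entry maps the identity, exact hot redraws, idle cold replicas (identity kernels — sector-idle and reversible), sector `A = {⊤}`.  One-sided
domination `p·μ_k(u) ≤ μ_0(u)` reads `pθ ≤ pθ` and `p(1−θ) ≤ 1 − pθ`, i.e. `p ≤ 1`: a trivializing map whose push-forward gives a sector the
fraction `p` of its cold weight is exactly a quality-`p` map, and it starves that sector by the factor `p`.

## What is proved

* `witnessLaw`, `witnessKernel` (local abbreviations inside statements only — no new definitions are introduced: the instance is written out).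
* **`boolWitness_oneSided`** — the instance satisfies `p·μ_{κ_r+1}(φ_r u) ≤ μ_0(u)` for every hub list `κ` (`p ≤ 1`).
* **`boolWitness_spectralGap_two_sided`** — `K ≥ 1`, `m ≥ 1`, multiplicities `≥ c ≥ 1`, `0 < t < 1`, `w ≥ 0`, `Σw = 1`, `w_0 > 0`, `0 < p ≤ 1`, `0 < θ < 1`:
  **`p·min{ct/(3m), (1−t)w_0/(7K)} ≤ Gap ≤ (p/(K(1−θ)))·min{t, (1−t)w_0}`**.
* **`boolWitness_relaxationTime_two_sided`** — **`(1−θ)K/(p·min{t,(1−t)w_0}) ≤ t_rel ≤ 1/(p·min{ct/(3m), (1−t)w_0/(7K)})`**.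

Reading (no numerics implied): chapter N's regime-free laws `Gap, γ⋆ ≥ p·min{ct/(3m),(1−t)w_0/(7K)}`, `t_rel, τ_int ≤ 1/(p·min{…})` cannot lose their
factor `p` under their own hypotheses: for every ladder size, hub list, swap fraction and update allocation there is a quality-`p` instance whose gap is
at most `(p/(K(1−θ)))·min{t,(1−t)w_0}` — within the factor `3/(1−θ)` (swap budget, uniform listing) resp. `7/(1−θ)` (refresh budget) of the floor.
NOT CLAIMED: that lattice trivializing maps behave like the witness; the `log K`; anything measured.  Literature grade (cell rule): OWN EXAMPLE
(O1 discharged on two points); nothing cited as a fact; no new bib keys.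
-/

noncomputable section

open Finset Function
open Literature.Probability.MarkovChains

namespace Summit.Ventures.LatticeQCDFlow.Scaling

variable {K m : ℕ} {w : Fin (K + 1) → ℝ} {t p θ : ℝ}

section Witness
variable (κ : Fin m → Fin K)

/-! ## §1 The instance and its hypotheses -/

/-- The sums of the two-point laws: `Σ_b (if b then a else 1 − a) = 1`. [ours] -/
theorem sum_bool_law (a : ℝ) : ∑ b : Bool, (if b then a else 1 - a) = 1 := by
  rw [Fintype.sum_bool, if_pos rfl, if_neg Bool.false_ne_true]; ring

/-- The sector `{⊤}`: `Σ_{b ∈ {true}} (if b then a else 1 − a) = a`. [ours] -/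
theorem sum_sector_law (a : ℝ) : ∑ b ∈ ({true} : Finset Bool), (if b then a else 1 - a) = a := by
  rw [sum_singleton, if_pos rfl]

/-- The identity kernel and the exact redraw are row-stochastic. [ours] -/
theorem boolWitness_rowStochastic (hp0 : 0 ≤ p) (hp1 : p ≤ 1) (hθ0 : 0 ≤ θ) (hθ1 : θ ≤ 1) (k : Fin (K + 1)) :
    IsRowStochastic (fun u v : Bool =>
      if k = 0 then (if v then p * θ else 1 - p * θ) else (if u = v then (1 : ℝ) else 0)) := by
  refine ⟨fun u v => ?_, fun u => ?_⟩
  · by_cases hk : k = 0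
    · simp only [hk, if_true]
      split_ifs
      · exact mul_nonneg hp0 hθ0
      · nlinarith [mul_le_mul hp1 hθ1 hθ0 zero_le_one]
    · simp only [hk, if_false]; split_ifs <;> norm_num
  · by_cases hk : k = 0
    · simp only [hk, if_true]; exact sum_bool_law (p * θ)
    · simp only [hk, if_false]
      rw [Finset.sum_ite_eq univ u, if_pos (mem_univ _)]

/-- Both kernels are reversible for their laws. [ours] -/
theorem boolWitness_detailedBalance (k : Fin (K + 1)) :
    DetailedBalance (fun b : Bool => if k = 0 then (if b then p * θ else 1 - p * θ) else (if b then θ else 1 - θ))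
      (fun u v : Bool => if k = 0 then (if v then p * θ else 1 - p * θ) else (if u = v then (1 : ℝ) else 0)) := by
  intro u v
  by_cases hk : k = 0
  · simp only [hk, if_true]; ring
  · simp only [hk, if_false]
    by_cases huv : u = v
    · subst huv; rfl
    · rw [if_neg huv, if_neg (Ne.symm huv), mul_zero, mul_zero]

/-- **ONE-SIDED TRANSPORTED DOMINATION WITH CONSTANT EXACTLY `p`:** `p·μ_{κ_r+1}(u) ≤ μ_0(u)` on the witness (`0 ≤ p ≤ 1`, `0 ≤ θ`), with
equality at the rare point `⊤`. [ours] -/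
theorem boolWitness_oneSided (hp1 : p ≤ 1) (r : Fin m) (u : Bool) :
    p * (fun (k : Fin (K + 1)) (b : Bool) => if k = 0 then (if b then p * θ else 1 - p * θ) else (if b then θ else 1 - θ))
        (κ r).succ ((fun _ : Fin m => Equiv.refl Bool) r u)
      ≤ (fun (k : Fin (K + 1)) (b : Bool) => if k = 0 then (if b then p * θ else 1 - p * θ) else (if b then θ else 1 - θ)) 0 u := by
  simp only [Fin.succ_ne_zero, if_false, if_true, Equiv.refl_apply]
  cases u
  · simp only [Bool.false_eq_true, if_false]; nlinarith
  · simp only [if_true]; exact le_rfl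

/-- The cold replicas are sector-idle (identity kernels): `w_k·Q_k({⊤},{⊤}ᶜ) = 0` for `k ≠ 0`. [ours] -/
theorem boolWitness_idle (k : Fin (K + 1)) (hk : k ≠ 0) :
    w k * edgeMeasure (fun b : Bool => if k = 0 then (if b then p * θ else 1 - p * θ) else (if b then θ else 1 - θ))
      (fun u v : Bool => if k = 0 then (if v then p * θ else 1 - p * θ) else (if u = v then (1 : ℝ) else 0))
      ({true} : Finset Bool) ({true} : Finset Bool)ᶜ = 0 := by
  have hQ : edgeMeasure (fun b : Bool => if k = 0 then (if b then p * θ else 1 - p * θ) else (if b then θ else 1 - θ))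
      (fun u v : Bool => if k = 0 then (if v then p * θ else 1 - p * θ) else (if u = v then (1 : ℝ) else 0))
      ({true} : Finset Bool) ({true} : Finset Bool)ᶜ = 0 := by
    unfold edgeMeasure
    refine Finset.sum_eq_zero fun x hx => Finset.sum_eq_zero fun y hy => ?_
    have hx' : x = true := Finset.mem_singleton.mp hx
    have hy' : y ≠ true := fun h => (Finset.mem_compl.mp hy) (Finset.mem_singleton.mpr h)
    have hxy : x ≠ y := by rw [hx']; exact fun h => hy' h.symm
    simp only [hk, if_false, if_neg hxy, mul_zero]
  rw [hQ, mul_zero]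

/-! ## §2 The two-sided law and the relaxation time on the witness -/

/-- **THE TWO-SIDED GAP LAW IS ATTAINED WITH `p' = p`:** for every `K ≥ 1`, hub list with multiplicities `≥ c ≥ 1`, `0 < t < 1`, probability vector
`w` with `w_0 > 0`, `0 < p ≤ 1`, `0 < θ < 1`, the witness has **`p·min{ct/(3m), (1−t)w_0/(7K)} ≤ Gap ≤ (p/(K(1−θ)))·min{t, (1−t)w_0}`**. [ours] -/
theorem boolWitness_spectralGap_two_sided (hK : 1 ≤ K) (hm : 1 ≤ m) (ht0 : 0 < t) (ht1 : t < 1) (hw0 : ∀ k, 0 ≤ w k)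
    (hw00 : 0 < w 0) (hw1 : ∑ k, w k = 1) (hp0 : 0 < p) (hp1 : p ≤ 1) (hθ0 : 0 < θ) (hθ1 : θ < 1)
    {c : ℕ} (hc1 : 1 ≤ c) (hc : ∀ p' : Fin K, c ≤ (univ.filter (fun r : Fin m => κ r = p')).card) :
    p * min (c * t / (3 * m)) ((1 - t) * w 0 / (7 * K))
        ≤ spectralGap (tensorFun (fun (k : Fin (K + 1)) (b : Bool) =>
              if k = 0 then (if b then p * θ else 1 - p * θ) else (if b then θ else 1 - θ)))
            (fun y z : Fin (K + 1) → Bool =>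
              t * ptGraphSwap (fun (k : Fin (K + 1)) (b : Bool) =>
                    if k = 0 then (if b then p * θ else 1 - p * θ) else (if b then θ else 1 - θ))
                  (fun r : Fin m => (((0 : Fin (K + 1)), (κ r).succ) : Fin (K + 1) × Fin (K + 1)))
                  (fun _ : Fin m => Equiv.refl Bool) y z
                + (1 - t) * prodKernel w (fun (k : Fin (K + 1)) (u v : Bool) =>
                    if k = 0 then (if v then p * θ else 1 - p * θ) else (if u = v then (1 : ℝ) else 0)) y z)
      ∧ spectralGap (tensorFun (fun (k : Fin (K + 1)) (b : Bool) =>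
              if k = 0 then (if b then p * θ else 1 - p * θ) else (if b then θ else 1 - θ)))
            (fun y z : Fin (K + 1) → Bool =>
              t * ptGraphSwap (fun (k : Fin (K + 1)) (b : Bool) =>
                    if k = 0 then (if b then p * θ else 1 - p * θ) else (if b then θ else 1 - θ))
                  (fun r : Fin m => (((0 : Fin (K + 1)), (κ r).succ) : Fin (K + 1) × Fin (K + 1)))
                  (fun _ : Fin m => Equiv.refl Bool) y z
                + (1 - t) * prodKernel w (fun (k : Fin (K + 1)) (u v : Bool) =>
                    if k = 0 then (if v then p * θ else 1 - p * θ) else (if u = v then (1 : ℝ) else 0)) y z)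
        ≤ p / (K * (1 - θ)) * min t ((1 - t) * w 0) := by
  have hpθ1 : p * θ < 1 := by nlinarith
  have hμ : ∀ (k : Fin (K + 1)) (x : Bool), 0 < (fun (k : Fin (K + 1)) (b : Bool) =>
      if k = 0 then (if b then p * θ else 1 - p * θ) else (if b then θ else 1 - θ)) k x := by
    intro k x
    by_cases hk : k = 0
    · simp only [hk, if_true]; split_ifs; exacts [mul_pos hp0 hθ0, by linarith]
    · simp only [hk, if_false]; split_ifs; exacts [hθ0, by linarith]
  have hμ1 : ∀ k : Fin (K + 1), ∑ u, (fun (k : Fin (K + 1)) (b : Bool) =>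
      if k = 0 then (if b then p * θ else 1 - p * θ) else (if b then θ else 1 - θ)) k u = 1 := by
    intro k
    by_cases hk : k = 0
    · simp only [hk, if_true]; exact sum_bool_law _
    · simp only [hk, if_false]; exact sum_bool_law _
  have hM := fun k : Fin (K + 1) => boolWitness_rowStochastic (K := K) hp0.le hp1 hθ0.le hθ1.le k
  have hMrev := fun k : Fin (K + 1) => boolWitness_detailedBalance (K := K) (p := p) (θ := θ) k
  have hM0 : ∀ u v : Bool, (fun (k : Fin (K + 1)) (u v : Bool) =>
      if k = 0 then (if v then p * θ else 1 - p * θ) else (if u = v then (1 : ℝ) else 0)) 0 u v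
      = (fun (k : Fin (K + 1)) (b : Bool) => if k = 0 then (if b then p * θ else 1 - p * θ) else (if b then θ else 1 - θ)) 0 v := by
    intro u v; simp only [if_true]
  have hdom := boolWitness_oneSided κ (K := K) (θ := θ) hp1
  have hφA : ∀ (r : Fin m) (u : Bool), (fun _ : Fin m => Equiv.refl Bool) r u ∈ ({true} : Finset Bool) ↔ u ∈ ({true} : Finset Bool) :=
    fun r u => Iff.rfl
  have hcold : ∀ k : Fin (K + 1), k ≠ 0 → ∑ u ∈ ({true} : Finset Bool), (fun (k : Fin (K + 1)) (b : Bool) =>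
      if k = 0 then (if b then p * θ else 1 - p * θ) else (if b then θ else 1 - θ)) k u = θ := by
    intro k hk; simp only [hk, if_false]; exact sum_sector_law θ
  have hhot : ∑ u ∈ ({true} : Finset Bool), (fun (k : Fin (K + 1)) (b : Bool) =>
      if k = 0 then (if b then p * θ else 1 - p * θ) else (if b then θ else 1 - θ)) 0 u ≤ p * θ := by
    simp only [if_true]; exact (sum_sector_law (p * θ)).le
  have hidle := fun (k : Fin (K + 1)) (hk : k ≠ 0) => boolWitness_idle (K := K) (w := w) (p := p) (θ := θ) k hk
  exact tightSector_spectralGap_two_sided κ (fun _ : Fin m => Equiv.refl Bool) hK hm ht0 ht1 hw0 hw00 hw1 hμ hμ1 hM hMrev hM0 hp0 hp1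
    hdom hc1 hc hφA hθ0 hθ1 hcold hhot hidle

/-- **THE RELAXATION TIME IS `Θ(1/p)` ON THE WITNESS:** `(1−θ)K/(p·min{t, (1−t)w_0}) ≤ t_rel ≤ 1/(p·min{ct/(3m), (1−t)w_0/(7K)})`. [ours] -/
theorem boolWitness_relaxationTime_two_sided (hK : 1 ≤ K) (hm : 1 ≤ m) (ht0 : 0 < t) (ht1 : t < 1) (hw0 : ∀ k, 0 ≤ w k)
    (hw00 : 0 < w 0) (hw1 : ∑ k, w k = 1) (hp0 : 0 < p) (hp1 : p ≤ 1) (hθ0 : 0 < θ) (hθ1 : θ < 1)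
    {c : ℕ} (hc1 : 1 ≤ c) (hc : ∀ p' : Fin K, c ≤ (univ.filter (fun r : Fin m => κ r = p')).card) :
    (1 - θ) * K / (p * min t ((1 - t) * w 0))
        ≤ relaxationTime (fun y z : Fin (K + 1) → Bool =>
              t * ptGraphSwap (fun (k : Fin (K + 1)) (b : Bool) =>
                    if k = 0 then (if b then p * θ else 1 - p * θ) else (if b then θ else 1 - θ))
                  (fun r : Fin m => (((0 : Fin (K + 1)), (κ r).succ) : Fin (K + 1) × Fin (K + 1)))
                  (fun _ : Fin m => Equiv.refl Bool) y z
                + (1 - t) * prodKernel w (fun (k : Fin (K + 1)) (u v : Bool) =>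
                    if k = 0 then (if v then p * θ else 1 - p * θ) else (if u = v then (1 : ℝ) else 0)) y z)
      ∧ relaxationTime (fun y z : Fin (K + 1) → Bool =>
              t * ptGraphSwap (fun (k : Fin (K + 1)) (b : Bool) =>
                    if k = 0 then (if b then p * θ else 1 - p * θ) else (if b then θ else 1 - θ))
                  (fun r : Fin m => (((0 : Fin (K + 1)), (κ r).succ) : Fin (K + 1) × Fin (K + 1)))
                  (fun _ : Fin m => Equiv.refl Bool) y z
                + (1 - t) * prodKernel w (fun (k : Fin (K + 1)) (u v : Bool) =>
                    if k = 0 then (if v then p * θ else 1 - p * θ) else (if u = v then (1 : ℝ) else 0)) y z)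
          ≤ 1 / (p * min (c * t / (3 * m)) ((1 - t) * w 0 / (7 * K))) := by
  have hpθ1 : p * θ < 1 := by nlinarith
  have hμ : ∀ (k : Fin (K + 1)) (x : Bool), 0 < (fun (k : Fin (K + 1)) (b : Bool) =>
      if k = 0 then (if b then p * θ else 1 - p * θ) else (if b then θ else 1 - θ)) k x := by
    intro k x
    by_cases hk : k = 0
    · simp only [hk, if_true]; split_ifs; exacts [mul_pos hp0 hθ0, by linarith]
    · simp only [hk, if_false]; split_ifs; exacts [hθ0, by linarith]
  have hμ1 : ∀ k : Fin (K + 1), ∑ u, (fun (k : Fin (K + 1)) (b : Bool) =>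
      if k = 0 then (if b then p * θ else 1 - p * θ) else (if b then θ else 1 - θ)) k u = 1 := by
    intro k
    by_cases hk : k = 0
    · simp only [hk, if_true]; exact sum_bool_law _
    · simp only [hk, if_false]; exact sum_bool_law _
  have hM := fun k : Fin (K + 1) => boolWitness_rowStochastic (K := K) hp0.le hp1 hθ0.le hθ1.le k
  have hMrev := fun k : Fin (K + 1) => boolWitness_detailedBalance (K := K) (p := p) (θ := θ) k
  have hM0 : ∀ u v : Bool, (fun (k : Fin (K + 1)) (u v : Bool) =>
      if k = 0 then (if v then p * θ else 1 - p * θ) else (if u = v then (1 : ℝ) else 0)) 0 u v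
      = (fun (k : Fin (K + 1)) (b : Bool) => if k = 0 then (if b then p * θ else 1 - p * θ) else (if b then θ else 1 - θ)) 0 v := by
    intro u v; simp only [if_true]
  have hdom := boolWitness_oneSided κ (K := K) (θ := θ) hp1
  have hφA : ∀ (r : Fin m) (u : Bool), (fun _ : Fin m => Equiv.refl Bool) r u ∈ ({true} : Finset Bool) ↔ u ∈ ({true} : Finset Bool) :=
    fun r u => Iff.rfl
  have hcold : ∀ k : Fin (K + 1), k ≠ 0 → ∑ u ∈ ({true} : Finset Bool), (fun (k : Fin (K + 1)) (b : Bool) =>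
      if k = 0 then (if b then p * θ else 1 - p * θ) else (if b then θ else 1 - θ)) k u = θ := by
    intro k hk; simp only [hk, if_false]; exact sum_sector_law θ
  have hhot : ∑ u ∈ ({true} : Finset Bool), (fun (k : Fin (K + 1)) (b : Bool) =>
      if k = 0 then (if b then p * θ else 1 - p * θ) else (if b then θ else 1 - θ)) 0 u ≤ p * θ := by
    simp only [if_true]; exact (sum_sector_law (p * θ)).le
  have hidle := fun (k : Fin (K + 1)) (hk : k ≠ 0) => boolWitness_idle (K := K) (w := w) (p := p) (θ := θ) k hk
  exact ⟨tightSector_relaxationTime_ge κ (fun _ : Fin m => Equiv.refl Bool) hK hm ht0 ht1 hw0 hw00 hw1 hμ hμ1 hM hMrev hM0 hp0 hp1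
      hdom hc1 hc hφA hθ0 hθ1 hcold hhot hidle,
    dominatedStar_relaxationTime_le_regimeFree κ (fun _ : Fin m => Equiv.refl Bool) hK hm ht0 ht1 hw0 hw00 hw1 hμ hμ1 hM hMrev hM0
      hp0 hp1 hdom hc1 hc⟩

end Witness

end Summit.Ventures.LatticeQCDFlow.Scaling

end
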